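import Mathlib
import HarnessLib
import Summits.HubbardSuperconductivity.HubbardSuperconductivity.Theorems.KLProgrammeKLRegimeEngineTowerLevUnitsDefs

/-!
# Route `KLProgramme` — crux K3 ENGINE (stmt-HubbardSuperconductivity-20437 `KLRegimeEngineV17F2`), stub (b) v2, THE LEVELS PACKAGE (ℓ):
# THE FLOOR-KEYED LEVELLED UNITS AND ARRAYS — cure (ε) of the located «(ℓ)-LEV-ODD» (KL STATUS 2026-08-28 l.9456/9461/9498/9504/9527)
# (cell gate-hubbard-kl, seat hubbard-kl-k3c2-p3 g13; pen (R275)(A) GO-ε, located-risk #10; E1 may rename or supersede)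

The half-integer units of …TowerLevUnitsDefs (`klLevUnit … t p J ∝ (√2)^{−tJ}`) demand a level gain `2^{−tJ/2}` of every input, but sector counting pays — and
the REGISTERED `KernelNormsLevels` records — only the FLOOR table `2^{−levelGainExp(F)·J}`, `levelGainExp F = min ((F−1)/2) 2` (`= 0, 0, 1, 1, 2` for
`F = 1 … 5`; BGM 2006 Lemma 2.4/2.5: gains only at `F = 3` (`γ^{h/2}`) and `F = 5` (`γ^h`)); the two systems agree at even tracks `t = 0, 2, 4` and differ by
`(√2)^{J}` at `t = 1, 3` (located «(ℓ)-LEV-ODD», k3c3-p2 g14 evidence #54 + k3c2-p3 g13).  This file RE-KEYS the units on the registered table, keeping the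
track index `t : Fin 5` and every array shape of …TowerLevUnitsDefs so that the array/profile/LINK rows are name-level twins:

* `klLevGain t := levelGainExp (t + 1)` (`= t/2` rounded down), `klLevRatioF t p := 8^p/(32·2^{klLevGain t})`,
  `klLevUnitF β M t p J := ε^{2p−1}·8^{Jp}/(2^{5J}·2^{klLevGain t·J})`, `klLevUnitF_succ/_add/_pos`, `klLevUnitF_zero_track` (track `0` = the old track `0`),
  `klLevUnit_le_klLevUnitF` (the half unit is the smaller: `(√2)^t ≥ 2^{⌊t/2⌋}`);
* `klTowerBLevF`, `klTowerMuLevAtF`, `klTowerMuLevF` — the born / per-track measured / track-blind measured arrays in the floor units (same carriers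
  `klTowerBornLev`, `klTowerMeasLev`), with `_zero`, `_succ`, nonnegativity, `klTowerMuLevAtF_le_klTowerMuLevF`, `exists_klTowerMuLevF_eq`,
  and `klTowerMuLevAtF_le_klTowerMuLevAt` (floor arrays are SMALLER than the half-keyed ones: every landed upper bound on `klTowerMuLevAt` transfers).
Definitions + elementary rows only; nothing about the model is asserted; nothing asserts (ℓ), any stub, K3 or superconductivity.
References: BGM 2006 §2.8 Lemma 2.4/2.5 (2.97)–(2.98), App. A4 (A4.2) [cite: BenfattoGiulianiMastropietro2006].
-/

noncomputable section

namespace Summit.HubbardSuperconductivity.HubbardSuperconductivity.Theorems.EngineV8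

set_option linter.dupNamespace false -- summit = problem name (single-conjunct summit), D-0017

open Classical
open Real Finset Literature.MathematicalPhysics.QuantumLattice Literature.Probability.LatticeModels GrassmannAlgebra
open Literature.MathematicalPhysics.QuantumLattice.FermiRG
open Summit.HubbardSuperconductivity.HubbardSuperconductivity.Theorems.KLRegimeSplit
open Summit.HubbardSuperconductivity.HubbardSuperconductivity.Theorems.KLProgrammeLegKernels
open Summit.HubbardSuperconductivity.HubbardSuperconductivity.Theorems.DispersionFlow

/-! ## §1 The floor-keyed units -/

/-- **`klLevGain t`** — the integer level-gain exponent of track `t` (`F = t + 1` known legs): the registered `levelGainExp (t + 1)`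
(`0, 0, 1, 1, 2` for `t = 0 … 4`; BGM 2006 Lemma 2.5 (2.98)). -/
def klLevGain (t : Fin 5) : ℕ := levelGainExp ((t : ℕ) + 1)

/-- `klLevGain t ≤ 2`. -/
theorem klLevGain_le_two (t : Fin 5) : klLevGain t ≤ 2 := levelGainExp_le_two _

/-- The floor gain is at most the half gain: `2^{klLevGain t} ≤ (√2)^t` (`2·⌊t/2⌋ ≤ t`). -/
theorem two_pow_klLevGain_le_sqrt_two_pow (t : Fin 5) : (2 : ℝ) ^ klLevGain t ≤ Real.sqrt 2 ^ (t : ℕ) := by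
  have h2 : (2 : ℝ) = Real.sqrt 2 ^ 2 := (Real.sq_sqrt (by norm_num : (0 : ℝ) ≤ 2)).symm
  have hle : 2 * klLevGain t ≤ (t : ℕ) := by
    unfold klLevGain levelGainExp
    have := t.isLt
    omega
  calc (2 : ℝ) ^ klLevGain t = Real.sqrt 2 ^ (2 * klLevGain t) := by rw [pow_mul, ← h2]
    _ ≤ Real.sqrt 2 ^ (t : ℕ) := pow_le_pow_right₀ (Real.one_le_sqrt.2 (by norm_num)) hle

/-- **`klLevRatioF t p`** — the one-family-step unit ratio of track `t` in degree `2p`, floor-keyed: `8^p/(32·2^{klLevGain t})`. -/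
def klLevRatioF (t : Fin 5) (p : ℕ) : ℝ := (8 : ℝ) ^ p / (32 * (2 : ℝ) ^ klLevGain t)

/-- **`klLevUnitF β M t p J`** — the floor-keyed unit of track `t`, degree `2p`, family `J`: `ε^{2p−1}·8^{J·p}/(2^{5J}·2^{klLevGain t·J})`. -/
def klLevUnitF (β : ℝ) (M : ℕ) (t : Fin 5) (p J : ℕ) : ℝ :=
  imagTimeWeight β M ^ (2 * p - 1) * (8 : ℝ) ^ (J * p) / ((2 : ℝ) ^ (5 * J) * (2 : ℝ) ^ (klLevGain t * J))

/-- The floor ratio is positive. -/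
theorem klLevRatioF_pos (t : Fin 5) (p : ℕ) : 0 < klLevRatioF t p := by
  unfold klLevRatioF; positivity

/-- The floor unit is positive (`0 < β`, `M ≠ 0`). -/
theorem klLevUnitF_pos {β : ℝ} (hβ : 0 < β) {M : ℕ} [NeZero M] (t : Fin 5) (p J : ℕ) : 0 < klLevUnitF β M t p J := by
  have hε : 0 < imagTimeWeight β M := by
    unfold imagTimeWeight
    have : (0 : ℝ) < M := Nat.cast_pos.2 (Nat.pos_of_ne_zero (NeZero.ne M))
    positivity
  unfold klLevUnitF; positivity

/-- **One family step multiplies the floor unit by the floor ratio.** -/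
theorem klLevUnitF_succ (β : ℝ) (M : ℕ) (t : Fin 5) (p J : ℕ) :
    klLevUnitF β M t p (J + 1) = klLevUnitF β M t p J * klLevRatioF t p := by
  unfold klLevUnitF klLevRatioF
  have h2 : (2 : ℝ) ^ (5 * (J + 1)) = (2 : ℝ) ^ (5 * J) * 32 := by rw [Nat.mul_succ, pow_add]; norm_num
  have h8 : (8 : ℝ) ^ ((J + 1) * p) = (8 : ℝ) ^ (J * p) * (8 : ℝ) ^ p := by rw [Nat.succ_mul, pow_add]
  have hg : (2 : ℝ) ^ (klLevGain t * (J + 1)) = (2 : ℝ) ^ (klLevGain t * J) * (2 : ℝ) ^ klLevGain t := by rw [Nat.mul_succ, pow_add]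
  rw [h2, h8, hg]
  field_simp

/-- **`n` family steps**: `klLevUnitF … (J + n) = klLevUnitF … J · (klLevRatioF t p)^n`. -/
theorem klLevUnitF_add (β : ℝ) (M : ℕ) (t : Fin 5) (p J n : ℕ) :
    klLevUnitF β M t p (J + n) = klLevUnitF β M t p J * klLevRatioF t p ^ n := by
  induction n with
  | zero => simp
  | succ n ih => rw [← Nat.add_assoc, klLevUnitF_succ, ih, pow_succ, mul_assoc]

/-- **Track `0` is unchanged**: `klLevUnitF β M 0 p J = klLevUnit β M 0 p J`. -/
theorem klLevUnitF_zero_track (β : ℝ) (M : ℕ) (p J : ℕ) : klLevUnitF β M 0 p J = klLevUnit β M 0 p J := by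
  unfold klLevUnitF klLevUnit klLevGain levelGainExp
  simp

/-- **The half-keyed unit is the smaller one**: `klLevUnit β M t p J ≤ klLevUnitF β M t p J` (`2^{⌊t/2⌋J} ≤ (√2)^{tJ}`; `β ≥ 0`). -/
theorem klLevUnit_le_klLevUnitF {β : ℝ} (hβ : 0 ≤ β) (M : ℕ) (t : Fin 5) (p J : ℕ) : klLevUnit β M t p J ≤ klLevUnitF β M t p J := by
  have hε : 0 ≤ imagTimeWeight β M := imagTimeWeight_nonneg hβ M
  unfold klLevUnitF klLevUnit
  have hpow : (2 : ℝ) ^ (klLevGain t * J) ≤ Real.sqrt 2 ^ ((t : ℕ) * J) := by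
    rw [pow_mul, pow_mul]
    exact pow_le_pow_left₀ (by positivity) (two_pow_klLevGain_le_sqrt_two_pow t) J
  exact div_le_div_of_nonneg_left (by positivity) (by positivity) (mul_le_mul_of_nonneg_left hpow (by positivity))

/-! ## §2 The floor-keyed arrays -/

variable (L M : ℕ) [NeZero L]

/-- **`klTowerBLevF`** — the born levelled array in floor units (block `k ≥ 1 ↦ Δ_{k−1}` at `F_{d(k−1)}`; `0` at `k = 0`). -/
def klTowerBLevF (β U μ : ℝ) (K : TrigPolyC4v) (d : ℕ) (t : Fin 5) (k p : ℕ) : ℝ :=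
  if k = 0 then 0 else klTowerBornLev L M β U μ K d (k - 1) (2 * p) ((t : ℕ) + 1) / klLevUnitF β M t p (d * (k - 1))

/-- **`klTowerMuLevAtF`** — the per-track measured array of the input of block `k` at `F_{dk−1}`, floor units, weight `27^{t+1}`. -/
def klTowerMuLevAtF (β U μ : ℝ) (K : TrigPolyC4v) (d : ℕ) (t : Fin 5) (k m : ℕ) : ℝ :=
  (27 : ℝ) ^ ((t : ℕ) + 1) * klTowerMeasLev L M β U μ K d k (2 * m) ((t : ℕ) + 1) / klLevUnitF β M t m (d * k - 1)

/-- **`klTowerMuLevF`** — the track-blind measured array in floor units (max over the five tracks). -/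
def klTowerMuLevF (β U μ : ℝ) (K : TrigPolyC4v) (d k m : ℕ) : ℝ :=
  (univ : Finset (Fin 5)).sup' univ_nonempty fun t => klTowerMuLevAtF L M β U μ K d t k m

variable {L M}

/-- The floor born array vanishes at block index `0`. -/
theorem klTowerBLevF_zero (β U μ : ℝ) (K : TrigPolyC4v) (d : ℕ) (t : Fin 5) (p : ℕ) : klTowerBLevF L M β U μ K d t 0 p = 0 := by
  simp [klTowerBLevF]

/-- The floor born array at block index `k + 1`. -/
theorem klTowerBLevF_succ (β U μ : ℝ) (K : TrigPolyC4v) (d : ℕ) (t : Fin 5) (k p : ℕ) :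
    klTowerBLevF L M β U μ K d t (k + 1) p = klTowerBornLev L M β U μ K d k (2 * p) ((t : ℕ) + 1) / klLevUnitF β M t p (d * k) := by
  simp [klTowerBLevF]

/-- Nonnegativity of the floor born array. -/
theorem klTowerBLevF_nonneg [NeZero M] {β : ℝ} (hβ : 0 < β) (U μ : ℝ) (K : TrigPolyC4v) (d : ℕ) (t : Fin 5) (k p : ℕ) :
    0 ≤ klTowerBLevF L M β U μ K d t k p := by
  unfold klTowerBLevF
  split_ifs
  · exact le_rfl
  · exact div_nonneg (klTowerBornLev_nonneg hβ.le U μ K d _ _ _) (klLevUnitF_pos hβ t p _).le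

/-- Nonnegativity of the per-track floor measured array. -/
theorem klTowerMuLevAtF_nonneg [NeZero M] {β : ℝ} (hβ : 0 < β) (U μ : ℝ) (K : TrigPolyC4v) (d : ℕ) (t : Fin 5) (k m : ℕ) :
    0 ≤ klTowerMuLevAtF L M β U μ K d t k m := by
  unfold klTowerMuLevAtF
  exact div_nonneg (mul_nonneg (by positivity) (klTowerMeasLev_nonneg hβ.le U μ K d k _ _)) (klLevUnitF_pos hβ t m _).le

/-- Every track's floor array is at most the track-blind one. -/
theorem klTowerMuLevAtF_le_klTowerMuLevF (β U μ : ℝ) (K : TrigPolyC4v) (d : ℕ) (t : Fin 5) (k m : ℕ) :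
    klTowerMuLevAtF L M β U μ K d t k m ≤ klTowerMuLevF L M β U μ K d k m :=
  le_sup' (fun t' => klTowerMuLevAtF L M β U μ K d t' k m) (mem_univ t)

/-- The track-blind floor array is attained at some track. -/
theorem exists_klTowerMuLevF_eq (β U μ : ℝ) (K : TrigPolyC4v) (d k m : ℕ) :
    ∃ t : Fin 5, klTowerMuLevF L M β U μ K d k m = klTowerMuLevAtF L M β U μ K d t k m := by
  obtain ⟨t, -, ht⟩ := exists_mem_eq_sup' (univ_nonempty : (univ : Finset (Fin 5)).Nonempty)
    (fun t' => klTowerMuLevAtF L M β U μ K d t' k m)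
  exact ⟨t, ht⟩

/-- Nonnegativity of the track-blind floor array. -/
theorem klTowerMuLevF_nonneg [NeZero M] {β : ℝ} (hβ : 0 < β) (U μ : ℝ) (K : TrigPolyC4v) (d k m : ℕ) :
    0 ≤ klTowerMuLevF L M β U μ K d k m :=
  (klTowerMuLevAtF_nonneg hβ U μ K d 0 k m).trans (klTowerMuLevAtF_le_klTowerMuLevF β U μ K d 0 k m)

/-- **Floor arrays are dominated by the half-keyed ones**: `klTowerMuLevAtF ≤ klTowerMuLevAt` (the floor unit is the larger), so every landed upper bound on
`klTowerMuLevAt`/`klTowerMuLev` transfers to the floor arrays. -/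
theorem klTowerMuLevAtF_le_klTowerMuLevAt [NeZero M] {β : ℝ} (hβ : 0 < β) (U μ : ℝ) (K : TrigPolyC4v) (d : ℕ) (t : Fin 5) (k m : ℕ) :
    klTowerMuLevAtF L M β U μ K d t k m ≤ klTowerMuLevAt L M β U μ K d t k m := by
  unfold klTowerMuLevAtF klTowerMuLevAt
  exact div_le_div_of_nonneg_left (mul_nonneg (by positivity) (klTowerMeasLev_nonneg hβ.le U μ K d k _ _)) (klLevUnit_pos hβ t m _)
    (klLevUnit_le_klLevUnitF hβ.le M t m _)

/-- **Track-blind version**: `klTowerMuLevF ≤ klTowerMuLev`. -/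
theorem klTowerMuLevF_le_klTowerMuLev [NeZero M] {β : ℝ} (hβ : 0 < β) (U μ : ℝ) (K : TrigPolyC4v) (d k m : ℕ) :
    klTowerMuLevF L M β U μ K d k m ≤ klTowerMuLev L M β U μ K d k m := by
  obtain ⟨t, ht⟩ := exists_klTowerMuLevF_eq (L := L) (M := M) β U μ K d k m
  rw [ht]
  exact (klTowerMuLevAtF_le_klTowerMuLevAt hβ U μ K d t k m).trans (klTowerMuLevAt_le_klTowerMuLev β U μ K d t k m)

/-- **The born arrays compare the other way**: `klTowerBLevF ≤ klTowerBLev` (the floor unit divides by more), so a floor-keyed law is WEAKER per block than the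
half-keyed one — but its inputs are payable. -/
theorem klTowerBLevF_le_klTowerBLev [NeZero M] {β : ℝ} (hβ : 0 < β) (U μ : ℝ) (K : TrigPolyC4v) (d : ℕ) (t : Fin 5) (k p : ℕ) :
    klTowerBLevF L M β U μ K d t k p ≤ klTowerBLev L M β U μ K d t k p := by
  unfold klTowerBLevF klTowerBLev
  split_ifs
  · exact le_rfl
  · exact div_le_div_of_nonneg_left (klTowerBornLev_nonneg hβ.le U μ K d _ _ _) (klLevUnit_pos hβ t p _) (klLevUnit_le_klLevUnitF hβ.le M t p _)

end Summit.HubbardSuperconductivity.HubbardSuperconductivity.Theorems.EngineV8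

end
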